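import Literature.Computability.AlgebraicComplexity.IMMInVPProofs
import Summits.ValiantsHypothesis.ValiantsHypothesis.Theorems.DivisionGapZeroOneTransferStubResidualIMM
import Summits.ValiantsHypothesis.ValiantsHypothesis.Theorems.DivisionGapZeroOneTransferStubZeroOneSpanCount

/-!
# Crux `DivisionGap.ZeroOneTransfer` (stmt-ValiantsHypothesis-5066) — the NISAN-WIDTH TRANSFER
(line `charged-uncharged`, Part C of lead c11: compositions of the landed stubs
`stub_residualIMM` p149981 and `stub_zeroOne_ncard_le_two_pow_finrank` p150838 with the tree's
`complexity_aeval_le`, `complexity_immPoly_le`)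

H2 (`ZeroOneTransfer`) asks whether 0/1 coefficients transfer a cheap SIGNED computation into a
cheap POSITIVE one (with one division, quasi-polynomial loss).  This file kernel-checks the one
model in which such a transfer IS a theorem — Nisan's rank-characterised model (weighted automata /
read-once oblivious ABPs; STRATEGY-CENSUS §1a(α) of the crux chain, the "solved sibling"):

* `complexity_le_of_fewResiduals`: in a fixed variable order `x₀, …, x_{N-1}` let the
  PREFIX-RESIDUALS of `f ∈ ℝ≥0[x]` at cut `i` be `Σ_{m : m|_{<i} = u} coeff_m(f) · x^{m|_{≥ i}}`
  (`u` over prefix exponents; the rows of Nisan's `i`-th partial-coefficient matrix, and `0`).  If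
  at every cut at most `W` distinct residuals occur and individual degrees are `≤ d`, then
  `L₊(f) ≤ (N+2)(W+1)³(d+2)²` — MONOTONE circuits, no subtraction, no division (the residual
  automaton is an iterated matrix product, `stub_residualIMM`).
* `complexity_le_of_nisanRank`: for 0/1 coefficients `W ≤ 2^r`, `r` the real dimension of the
  residual span (`stub_zeroOne_ncard_le_two_pow_finrank`), so `L₊(f) ≤ (N+2)(2^r+1)³(d+2)²`:
  "0/1 + rank `r` ⇒ positive, with loss `2^r`", i.e. H2 with `h = 1` holds in the
  rank-characterised model.  Calibration for the crux: quasi-polynomial (not polynomial) loss is the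
  natural scale of any 0/1 ⇒ positive transfer (the polylog-rank form of this statement is already
  the log-rank conjecture, census §1a(β)), and the lever has nothing to act on for circuits (no
  coefficient matrix of a generic `VP` polynomial has small rank —
  `Literature.Barriers.ValiantsHypothesis.RankMethods`).

No `def` is declared (residuals are written inline with `Finsupp.filter`).
[cite: Nisan1991Noncommutative, Thm. 1]
-/

open MvPolynomial
open Literature.Computability.AlgebraicComplexity
open scoped NNReal BigOperators

-- `Summit.ValiantsHypothesis.ValiantsHypothesis.…`: mandated single-conjunct layout (Sub = Summit).
set_option linter.dupNamespace false

namespace Summit.ValiantsHypothesis.ValiantsHypothesis.Theorems.DivisionGapZeroOneTransfer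

/-- **Monotone complexity is polynomial in the residual width** (from the registered stub `stub_residualIMM` and the tree's
`complexity_aeval_le`, `complexity_immPoly_le`): at most `W` distinct prefix-residuals at every cut
and individual degrees `≤ d` give `L₊(f) ≤ (N+2)(W+1)³(d+2)²` — no subtraction, no division.
[cite: Nisan1991Noncommutative, Thm. 1] -/
theorem complexity_le_of_fewResiduals :
    ∀ (N d W : ℕ) (f : MvPolynomial (Fin N) NNReal),
      (∀ m ∈ f.support, ∀ j : Fin N, m j ≤ d) →
      (∀ i : ℕ, i ≤ N →
        {g : MvPolynomial (Fin N) NNReal | ∃ u : Fin N →₀ ℕ,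
            g = ∑ m ∈ f.support with Finsupp.filter (fun j : Fin N => (j : ℕ) < i) m = u,
                  MvPolynomial.monomial (Finsupp.filter (fun j : Fin N => i ≤ (j : ℕ)) m)
                    (MvPolynomial.coeff m f)}.ncard ≤ W) →
      Literature.Computability.AlgebraicComplexity.complexity f ≤
        (N + 2) * (W + 1) ^ 3 * (d + 2) ^ 2 := by
  intro N d W f hd hW
  obtain ⟨g, hfg, hg⟩ := stub_residualIMM N d W f hd hW
  have h1 : Literature.Computability.AlgebraicComplexity.complexity f ≤
      ((W + 1) + 2 * (W + 1) ^ 3 * (N + 2)) +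
        ∑ _t : Fin (N + 2) × Fin (W + 1) × Fin (W + 1), (d + 1) ^ 2 := by
    rw [hfg]
    calc Literature.Computability.AlgebraicComplexity.complexity
          (MvPolynomial.aeval g (immPoly (W + 1) (N + 2) NNReal))
        ≤ Literature.Computability.AlgebraicComplexity.complexity (immPoly (W + 1) (N + 2) NNReal) +
            ∑ t, Literature.Computability.AlgebraicComplexity.complexity (g t) :=
          complexity_aeval_le _ _
      _ ≤ ((W + 1) + 2 * (W + 1) ^ 3 * (N + 2)) +
            ∑ _t : Fin (N + 2) × Fin (W + 1) × Fin (W + 1), (d + 1) ^ 2 :=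
          Nat.add_le_add (complexity_immPoly_le NNReal (W + 1) (N + 2))
            (Finset.sum_le_sum fun t _ => hg t)
  refine h1.trans ?_
  rw [Finset.sum_const, Finset.card_univ, smul_eq_mul, Fintype.card_prod, Fintype.card_prod,
    Fintype.card_fin, Fintype.card_fin]
  have hW1 : 1 ≤ W + 1 := Nat.succ_pos W
  have hsq : (W + 1) * (W + 1) ≤ (W + 1) ^ 3 := by
    calc (W + 1) * (W + 1) = (W + 1) ^ 2 * 1 := by ring
      _ ≤ (W + 1) ^ 2 * (W + 1) := Nat.mul_le_mul_left _ hW1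
      _ = (W + 1) ^ 3 := by ring
  have hlin : W + 1 ≤ (W + 1) ^ 3 * (N + 2) := by
    calc W + 1 = (W + 1) * 1 * 1 := by ring
      _ ≤ (W + 1) * ((W + 1) * (W + 1)) * (N + 2) :=
          Nat.mul_le_mul (Nat.mul_le_mul_left _ (Nat.mul_le_mul hW1 hW1)) (by omega)
      _ = (W + 1) ^ 3 * (N + 2) := by ring
  calc (W + 1) + 2 * (W + 1) ^ 3 * (N + 2) + (N + 2) * ((W + 1) * (W + 1)) * (d + 1) ^ 2
      ≤ (W + 1) ^ 3 * (N + 2) + 2 * (W + 1) ^ 3 * (N + 2) + (N + 2) * (W + 1) ^ 3 * (d + 1) ^ 2 := by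
        gcongr
    _ = (N + 2) * (W + 1) ^ 3 * (3 + (d + 1) ^ 2) := by ring
    _ ≤ (N + 2) * (W + 1) ^ 3 * (d + 2) ^ 2 := Nat.mul_le_mul_left _ (by
        calc 3 + (d + 1) ^ 2 = d * d + 2 * d + 4 := by ring
          _ ≤ d * d + 4 * d + 4 := by omega
          _ = (d + 2) ^ 2 := by ring)

/-- Coefficients of a prefix-residual are coefficients of `f` or `0`: the monomials `m` of `f` with
prefix `u` and suffix `m'` number at most one (`m = u + m'`). [folklore] -/
theorem coeff_residual_zero_or_one {N : ℕ} (f : MvPolynomial (Fin N) NNReal)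
    (hf : ∀ m, MvPolynomial.coeff m f = 0 ∨ MvPolynomial.coeff m f = 1) (i : ℕ)
    (u m' : Fin N →₀ ℕ) :
    MvPolynomial.coeff m'
        (∑ m ∈ f.support with Finsupp.filter (fun j : Fin N => (j : ℕ) < i) m = u,
          MvPolynomial.monomial (Finsupp.filter (fun j : Fin N => i ≤ (j : ℕ)) m)
            (MvPolynomial.coeff m f)) = 0 ∨
      MvPolynomial.coeff m'
        (∑ m ∈ f.support with Finsupp.filter (fun j : Fin N => (j : ℕ) < i) m = u,
          MvPolynomial.monomial (Finsupp.filter (fun j : Fin N => i ≤ (j : ℕ)) m)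
            (MvPolynomial.coeff m f)) = 1 := by
  classical
  rw [MvPolynomial.coeff_sum]
  simp only [MvPolynomial.coeff_monomial]
  -- every summand vanishes unless `m = u + m'`
  have key : ∀ m ∈ f.support.filter (fun m => Finsupp.filter (fun j : Fin N => (j : ℕ) < i) m = u),
      (if Finsupp.filter (fun j : Fin N => i ≤ (j : ℕ)) m = m' then MvPolynomial.coeff m f else 0) =
        if m = u + m' then MvPolynomial.coeff (u + m') f *
          (if Finsupp.filter (fun j : Fin N => (j : ℕ) < i) (u + m') = u ∧
              Finsupp.filter (fun j : Fin N => i ≤ (j : ℕ)) (u + m') = m' then 1 else 0) else 0 := by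
    intro m hm
    rw [Finset.mem_filter] at hm
    obtain ⟨-, hpre⟩ := hm
    by_cases hsuf : Finsupp.filter (fun j : Fin N => i ≤ (j : ℕ)) m = m'
    · have hm : m = u + m' := by
        rw [← hpre, ← hsuf]
        ext j
        simp only [Finsupp.add_apply, Finsupp.filter_apply]
        by_cases hj : (j : ℕ) < i
        · rw [if_pos hj, if_neg (not_le.2 hj), add_zero]
        · rw [if_neg hj, if_pos (not_lt.1 hj), zero_add]
      subst hm
      rw [if_pos hsuf, if_pos rfl, if_pos ⟨hpre, hsuf⟩, mul_one]
    · rw [if_neg hsuf]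
      by_cases hm : m = u + m'
      · subst hm
        rw [if_pos rfl, if_neg (fun h => hsuf h.2), mul_zero]
      · rw [if_neg hm]
  rw [Finset.sum_congr rfl key, Finset.sum_ite_eq' ]
  split_ifs with h1 h2
  · rw [mul_one]; exact hf _
  · left; rw [mul_zero]
  · left; rfl

/-- **H2 WITH `h = 1` IN NISAN'S MODEL** (composition of the registered stubs `stub_residualIMM`,
`stub_zeroOne_ncard_le_two_pow_finrank`): a 0/1 polynomial over `ℝ≥0`
whose prefix-residual spans (realified) have real dimension `≤ r` at every cut of a fixed variable
order — e.g. one computed by a read-once oblivious ABP of width `r` in that order over any field of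
characteristic `0` — has MONOTONE circuits of size `≤ (N+2)(2^r+1)³(d+2)²`: the transfer
"0/1 + small rank ⇒ positive, with loss `2^{rank}`" of STRATEGY-CENSUS §1a(α), kernel-checked.
[cite: Nisan1991Noncommutative, Thm. 1] -/
theorem complexity_le_of_nisanRank :
    ∀ (N d r : ℕ) (f : MvPolynomial (Fin N) NNReal),
      (∀ m, MvPolynomial.coeff m f = 0 ∨ MvPolynomial.coeff m f = 1) →
      (∀ m ∈ f.support, ∀ j : Fin N, m j ≤ d) →
      (∀ i : ℕ, i ≤ N →
        Module.finrank ℝ (Submodule.span ℝ ((MvPolynomial.map NNReal.toRealHom) ''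
          {g : MvPolynomial (Fin N) NNReal | ∃ u : Fin N →₀ ℕ,
            g = ∑ m ∈ f.support with Finsupp.filter (fun j : Fin N => (j : ℕ) < i) m = u,
                  MvPolynomial.monomial (Finsupp.filter (fun j : Fin N => i ≤ (j : ℕ)) m)
                    (MvPolynomial.coeff m f)})) ≤ r) →
      Literature.Computability.AlgebraicComplexity.complexity f ≤
        (N + 2) * (2 ^ r + 1) ^ 3 * (d + 2) ^ 2 := by
  intro N d r f hf hd hr
  classical
  refine complexity_le_of_fewResiduals N d (2 ^ r) f hd fun i hi => ?_
  set R : Set (MvPolynomial (Fin N) NNReal) := {g : MvPolynomial (Fin N) NNReal | ∃ u : Fin N →₀ ℕ,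
          g = ∑ m ∈ f.support with Finsupp.filter (fun j : Fin N => (j : ℕ) < i) m = u,
                MvPolynomial.monomial (Finsupp.filter (fun j : Fin N => i ≤ (j : ℕ)) m)
                  (MvPolynomial.coeff m f)} with hR
  -- finiteness: every residual is the residual of a prefix of a support monomial, or `0`
  have hfin : R.Finite := by
    have hsub : R ⊆ insert 0 ((fun u => ∑ m ∈ f.support with
        Finsupp.filter (fun j : Fin N => (j : ℕ) < i) m = u,
          MvPolynomial.monomial (Finsupp.filter (fun j : Fin N => i ≤ (j : ℕ)) m)
            (MvPolynomial.coeff m f)) ''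
        ((fun m => Finsupp.filter (fun j : Fin N => (j : ℕ) < i) m) '' (f.support : Set (Fin N →₀ ℕ)))) := by
      rintro g ⟨u, rfl⟩
      by_cases hu : ∃ m ∈ f.support, Finsupp.filter (fun j : Fin N => (j : ℕ) < i) m = u
      · obtain ⟨m, hm, hmu⟩ := hu
        exact Set.mem_insert_of_mem _ ⟨u, ⟨m, hm, hmu⟩, rfl⟩
      · push Not at hu
        refine Set.mem_insert_iff.2 (Or.inl ?_)
        apply Finset.sum_eq_zero
        intro m hm
        rw [Finset.mem_filter] at hm
        exact absurd hm.2 (hu m hm.1)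
    exact ((Set.Finite.image _ ((Finset.finite_toSet _).image _)).insert 0).subset hsub
  -- the realification is injective and preserves 0/1 coefficients
  have hinj : Function.Injective
      (MvPolynomial.map NNReal.toRealHom : MvPolynomial (Fin N) NNReal → MvPolynomial (Fin N) ℝ) :=
    MvPolynomial.map_injective _ NNReal.coe_injective
  have hcard : R.ncard = ((MvPolynomial.map NNReal.toRealHom) '' R).ncard :=
    (Set.ncard_image_of_injective R hinj).symm
  rw [hcard]
  refine stub_zeroOne_ncard_le_two_pow_finrank (Fin N) _ (hfin.image _) ?_ |>.trans
    (Nat.pow_le_pow_right Nat.two_pos (hr i hi))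
  rintro g ⟨g₀, ⟨u, rfl⟩, rfl⟩ m
  rw [MvPolynomial.coeff_map]
  rcases coeff_residual_zero_or_one f hf i u m with h0 | h1
  · left; rw [h0]; rfl
  · right; rw [h1]; rfl

end Summit.ValiantsHypothesis.ValiantsHypothesis.Theorems.DivisionGapZeroOneTransfer
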